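import Summits.BirchSwinnertonDyer.BirchSwinnertonDyer.Theorems.AlignedTransportAtTwoMainConjectureOfRankZeroBSDAtTwoFineRoadArchKernel
import Literature.NumberTheory.EllipticCurves.IwasawaSelmerDualProofs
import Literature.NumberTheory.EllipticCurves.IwasawaAlgebraProofs
import HarnessLib

/-!
# Road (b″) of crux C2 `MainConjectureOfRankZeroBSDAtTwo` (stmt-BirchSwinnertonDyer-22298), line `birth`:
# ORBIT LEMMA and ARCHIMEDEAN RIGIDITY — `Γ_K`-conjugates of a class of `H¹(K_∞, E[p^∞])` are `⟨γ⟩_ℕ`-conjugates;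
# a relaxed Selmer class whose `γ`-defect is Selmer is Selmer as soon as it is trivial at ONE conjugate of each real place;
# `μ`-bookkeeping `ℓ_𝔭(X^{rel ∞}) = ℓ_𝔭(ker q) + ℓ_𝔭(X)`

HONEST FRAMING (cell `bsd-f1-sign2`, attach seat `bsd-line-att-p4` g5, route `AlignedTransportAtTwo`; BSD is NOT proved by any of
this; the crux C2 stays OPEN — `blocked-on: Rank1Residual.GreenbergMuConjectureIrreducible`). THEOREMS ONLY;
`--supports stmt-BirchSwinnertonDyer-22298`, C2-NEUTRAL.

WHAT (all kernel, no named fact):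

* §1 **ORBIT LEMMA** (`exists_conjH1_eq_conjH1_pow`) — every number field `K`, every prime `p`, every `ℤ_p`-extension `κ` with a
  topological generator `γ`, every elliptic `W/K`: for each class `c ∈ H¹(K_∞, E[p^∞])` and each `σ ∈ Γ_K` there is `n : ℕ` with
  `conj_σ c = conj_{γⁿ} c`. Proof: `c` is fixed by an open normal subgroup `U` (continuity, tree `exists_openNormalSubgroup_conjH1_eq`),
  `κ(U) ⊇ p^a ℤ_p` (`[Γ_K : U] = p^a·e`, `p ∤ e`), `κ σ ≡ n (mod p^a)` for some `n ∈ ℕ`, so `σ = γⁿ·h·u` with `h ∈ ker κ` (acting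
  trivially, `conjH1_of_mem_holds`) and `u ∈ U`. Corollaries: `γ`-invariant ⟹ `Γ_K`-invariant (`conjH1_eq_self_of_conjH1_gen_eq_self`);
  the `γ`-defect `conj_γ c − c` in a `conj`-stable subgroup `S` ⟹ every defect `conj_σ c − c ∈ S` (`conjH1_sub_mem_of_conjH1_gen_sub_mem`).
* §2 **ARCHIMEDEAN RIGIDITY at `p = 2` over `ℚ`** (`mem_selmerInfty_of_relaxed_of_defect_of_localKer_inf`): a class
  `c ∈ Sel^{rel ∞}(ℚ_∞, E[2^∞])` (`Greenberg1999.relaxedSelmerInftyAtTwo`) whose `γ`-defect `conj_γ c − c` lies in `Sel_{2^∞}(E/ℚ_∞)` and which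
  satisfies the archimedean Kummer condition at the CHOSEN real place only (`c ∈ W.localKerOver 2 (ker κ) ℝ`) lies in `Sel_{2^∞}(E/ℚ_∞)` —
  i.e. `(Sel^{rel ∞}/Sel)^Γ ↪ H¹(ℚ_{∞,w₀}, E[2^∞])` at one real place `w₀` of `ℚ_∞` (dually: the `Γ`-coinvariants of the archimedean
  kernel `ker q` of `…FineRoadArchReceptacle` are detected at one place — the first step of Greenberg's `𝒫_∞ ≅ Hom(Λ/2Λ, ℤ/2)`).
* §3 **`μ`-BOOKKEEPING** for the archimedean extension `q : Xr ↠ D.X` of ANY pinned relaxed dual (`…FineRoadArchKernel/ArchReceptacle`):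
  `ℓ_𝔭(Xr) = ℓ_𝔭(ker q) + ℓ_𝔭(D.X)` at every prime `𝔭` of `Λ` (`lengthAt_relaxed_eq_lengthAt_ker_add`); hence `ℓ_𝔭(D.X) ≤ ℓ_𝔭(Xr)`,
  `Δ_W < 0 ⇒ ℓ_𝔭(Xr) = ℓ_𝔭(D.X)` (all `𝔭`), and — GRANTED Greenberg L.4.6 at `2` (PRINT p608868) — `Δ_W > 0 ⇒ ℓ₍₂₎(D.X) + 1 ≤ ℓ₍₂₎(Xr)`
  (`μ₂(X^{rel ∞}) ≥ μ₂(X) + 1`).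

References: R. Greenberg, LNM 1716 (1999), §1 p. 60, §4 Lemma 4.6 and Remark (PDF pp. 105–107); L. Washington, GTM 83, §13.1–13.2;
J.-P. Serre, *Galois Cohomology*, I §2.
-/

set_option autoImplicit false
-- the Theorems namespace of this sub repeats the summit name by design (D-0017 nested layout)
set_option linter.dupNamespace false

noncomputable section

open scoped Classical

namespace Summit.BirchSwinnertonDyer.BirchSwinnertonDyer.Theorems.AlignedTransportAtTwoFineRoad.ArchRigidity

open NumberField IsDedekindDomain Field WeierstrassCurve
open Literature.NumberTheory.EllipticCurves Literature.NumberTheory.EllipticCurves.IwasawaAlgebra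
  Literature.NumberTheory.EllipticCurves.Module Literature.NumberTheory.EllipticCurves.Greenberg1999
  Literature.NumberTheory.GaloisRepresentations ZpExtension

universe u

/-! ## §1 The orbit lemma: `Γ_K`-conjugates are `⟨γ⟩_ℕ`-conjugates -/

section Orbit

variable {K : Type u} [Field K] [NumberField K] (W : WeierstrassCurve K) {p : ℕ} [Fact p.Prime] (κ : ZpExtension K p)
  {γ : Field.absoluteGaloisGroup K}

/-- **Every `σ ∈ Γ_K` factors as `σ = γⁿ · h · u`** with `n : ℕ`, `h ∈ ker κ` and `u` in a prescribed open normal subgroup `U`,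
for `γ` a topological generator of the `ℤ_p`-extension `κ` (density of `ℕ·1` in `ℤ_p`: `κ(U) ⊇ p^a ℤ_p` where `[Γ_K : U] = p^a e`,
`p ∤ e`, and `κ σ ≡ n (mod p^a)`). [cite: Washington1997, §13.1] -/
theorem exists_eq_pow_mul_mem_kerSubgroup_mul_mem (hγ : κ.IsTopGenerator γ)
    (U : OpenNormalSubgroup (Field.absoluteGaloisGroup K)) (σ : Field.absoluteGaloisGroup K) :
    ∃ (n : ℕ) (h : Field.absoluteGaloisGroup K) (u : Field.absoluteGaloisGroup K),
      h ∈ κ.kerSubgroup ∧ u ∈ U ∧ σ = γ ^ n * h * u := by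
  have hp := (Fact.out : p.Prime)
  haveI : Finite (Field.absoluteGaloisGroup K ⧸ U.toSubgroup) := Subgroup.quotient_finite_of_isOpen _ U.isOpen
  have hd : U.toSubgroup.index ≠ 0 := Subgroup.index_ne_zero_of_finite
  obtain ⟨a, e, he, hde⟩ := Nat.exists_eq_pow_mul_and_not_dvd hd p hp.ne_one
  obtain ⟨ue, hue⟩ := IwasawaDual.isUnit_natCast_padicInt (p := p) he
  -- `x = κ σ`, `n = x mod p^a`, `x - n = p^a * y`
  set x : ℤ_[p] := (κ σ).toAdd with hx
  set n : ℕ := (PadicInt.toZModPow a x).val with hn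
  have hxn : PadicInt.toZModPow a (x - (n : ℤ_[p])) = 0 := by
    rw [map_sub, map_natCast, hn, ZMod.natCast_zmod_val, sub_self]
  have hmem : x - (n : ℤ_[p]) ∈ Ideal.span {(p : ℤ_[p]) ^ a} := by
    rw [← PadicInt.ker_toZModPow]; exact hxn
  obtain ⟨y, hy⟩ := Ideal.mem_span_singleton'.mp hmem
  -- `u = g₀ ^ d` with `κ g₀ = e⁻¹ y`, so that `κ u = p^a y`
  obtain ⟨g₀, hg₀⟩ := κ.surjective (Multiplicative.ofAdd (((ue⁻¹ : ℤ_[p]ˣ) : ℤ_[p]) * y))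
  have hg₀' : κ g₀ = Multiplicative.ofAdd (((ue⁻¹ : ℤ_[p]ˣ) : ℤ_[p]) * y) := hg₀
  have huU : g₀ ^ U.toSubgroup.index ∈ U := U.toSubgroup.pow_index_mem g₀
  have hκu : (κ (g₀ ^ U.toSubgroup.index)).toAdd = (p : ℤ_[p]) ^ a * y := by
    rw [map_pow, hg₀', ← ofAdd_nsmul, toAdd_ofAdd, nsmul_eq_mul, hde, Nat.cast_mul, Nat.cast_pow, ← hue]
    rw [show ((p : ℤ_[p]) ^ a * (ue : ℤ_[p])) * (((ue⁻¹ : ℤ_[p]ˣ) : ℤ_[p]) * y) =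
        (p : ℤ_[p]) ^ a * (((ue : ℤ_[p]) * ((ue⁻¹ : ℤ_[p]ˣ) : ℤ_[p])) * y) by ring, Units.mul_inv, one_mul]
  have hκγ : (κ (γ ^ n)).toAdd = (n : ℤ_[p]) := by
    rw [map_pow, show κ γ = Multiplicative.ofAdd 1 from hγ, ← ofAdd_nsmul, toAdd_ofAdd, nsmul_eq_mul, mul_one]
  -- `h = (γ^n)⁻¹ * σ * u⁻¹ ∈ ker κ`
  refine ⟨n, (γ ^ n)⁻¹ * σ * (g₀ ^ U.toSubgroup.index)⁻¹, g₀ ^ U.toSubgroup.index, ?_, huU, by group⟩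
  rw [ZpExtension.mem_kerSubgroup, map_mul, map_mul, map_inv, map_inv]
  apply Multiplicative.toAdd.injective
  rw [toAdd_mul, toAdd_mul, toAdd_inv, toAdd_inv, hκγ, hκu, toAdd_one]
  linear_combination (-1 : ℤ_[p]) * hy

/-- **ORBIT LEMMA.** For `γ` a topological generator of the `ℤ_p`-extension `κ` of the number field `K`, an elliptic `W/K`, a class
`c ∈ H¹(K_∞, E[p^∞])` and ANY `σ ∈ Γ_K`: `conj_σ c = conj_{γⁿ} c` for some `n : ℕ` — `c` is fixed by an open normal subgroup
(`exists_openNormalSubgroup_conjH1_eq`), by `ker κ` (`conjH1_of_mem_holds`), and `σ ∈ γⁿ · ker κ · U`. So the `Γ_K`-orbit of a class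
is its `⟨γ⟩_ℕ`-orbit. [cite: GreenbergLNM1716, §1 p. 60 (the action of `Γ = Gal(F_∞/F)` on `H¹(F_∞, E[p^∞])`)] [cite: Washington1997, §13.2] -/
theorem exists_conjH1_eq_conjH1_pow (hγ : κ.IsTopGenerator γ) (c : W.subgroupH1 p κ.kerSubgroup)
    (σ : Field.absoluteGaloisGroup K) :
    ∃ n : ℕ, W.conjH1 p κ.kerSubgroup σ c = W.conjH1 p κ.kerSubgroup (γ ^ n) c := by
  obtain ⟨U, hU⟩ := W.exists_openNormalSubgroup_conjH1_eq κ c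
  obtain ⟨n, h, u, hh, hu, rfl⟩ := exists_eq_pow_mul_mem_kerSubgroup_mul_mem κ hγ U σ
  refine ⟨n, ?_⟩
  rw [W.conjH1_mul_holds p κ.kerSubgroup (γ ^ n * h) u, AddMonoidHom.comp_apply, hU u hu,
    W.conjH1_mul_holds p κ.kerSubgroup (γ ^ n) h, AddMonoidHom.comp_apply, W.conjH1_of_mem_holds p κ.kerSubgroup hh,
    AddMonoidHom.id_apply]

/-- **`γ`-invariant ⟹ `Γ_K`-invariant**: a class of `H¹(K_∞, E[p^∞])` fixed by `conj_γ` (`γ` a topological generator) is fixed by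
every `conj_σ`, `σ ∈ Γ_K`. [cite: GreenbergLNM1716, §1 p. 60] -/
theorem conjH1_eq_self_of_conjH1_gen_eq_self (hγ : κ.IsTopGenerator γ) {c : W.subgroupH1 p κ.kerSubgroup}
    (hc : W.conjH1 p κ.kerSubgroup γ c = c) (σ : Field.absoluteGaloisGroup K) : W.conjH1 p κ.kerSubgroup σ c = c := by
  have hpow : ∀ n : ℕ, W.conjH1 p κ.kerSubgroup (γ ^ n) c = c := by
    intro n
    induction n with
    | zero => rw [pow_zero, W.conjH1_one_holds p κ.kerSubgroup, AddMonoidHom.id_apply]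
    | succ n ih => rw [pow_succ, W.conjH1_mul_holds p κ.kerSubgroup, AddMonoidHom.comp_apply, hc, ih]
  obtain ⟨n, hn⟩ := exists_conjH1_eq_conjH1_pow W κ hγ c σ
  rw [hn, hpow n]

/-- **`γ`-defect in `S` ⟹ every defect in `S`**: if `S ≤ H¹(K_∞, E[p^∞])` is stable under `conj_γ` and `conj_γ c − c ∈ S`, then
`conj_{γⁿ} c − c ∈ S` for all `n` (telescoping) and hence `conj_σ c − c ∈ S` for EVERY `σ ∈ Γ_K` (orbit lemma).
[cite: GreenbergLNM1716, §1 p. 60] -/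
theorem conjH1_sub_mem_of_conjH1_gen_sub_mem (hγ : κ.IsTopGenerator γ) {S : AddSubgroup (W.subgroupH1 p κ.kerSubgroup)}
    (hS : ∀ s ∈ S, W.conjH1 p κ.kerSubgroup γ s ∈ S) {c : W.subgroupH1 p κ.kerSubgroup}
    (hc : W.conjH1 p κ.kerSubgroup γ c - c ∈ S) (σ : Field.absoluteGaloisGroup K) :
    W.conjH1 p κ.kerSubgroup σ c - c ∈ S := by
  have hpow : ∀ n : ℕ, W.conjH1 p κ.kerSubgroup (γ ^ n) c - c ∈ S := by
    intro n
    induction n with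
    | zero => rw [pow_zero, W.conjH1_one_holds p κ.kerSubgroup, AddMonoidHom.id_apply, sub_self]; exact S.zero_mem
    | succ n ih =>
      have e : W.conjH1 p κ.kerSubgroup (γ ^ (n + 1)) c - c =
          W.conjH1 p κ.kerSubgroup γ (W.conjH1 p κ.kerSubgroup (γ ^ n) c - c) + (W.conjH1 p κ.kerSubgroup γ c - c) := by
        rw [pow_succ', W.conjH1_mul_holds p κ.kerSubgroup, AddMonoidHom.comp_apply, map_sub]
        abel
      rw [e]
      exact S.add_mem (hS _ ih) hc
  obtain ⟨n, hn⟩ := exists_conjH1_eq_conjH1_pow W κ hγ c σ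
  rw [hn]
  exact hpow n

end Orbit

/-! ## §2 Archimedean rigidity at `p = 2` over `ℚ`: `(Sel^{rel ∞}/Sel)^Γ ↪ H¹(ℚ_{∞,w₀}, E[2^∞])` -/

section Rigidity

variable (W : WeierstrassCurve ℚ) (κ : ZpExtension ℚ 2) {γ : Field.absoluteGaloisGroup ℚ}

/-- **ARCHIMEDEAN RIGIDITY.** For `γ` a topological generator, a class `c ∈ Sel^{rel ∞}(ℚ_∞, E[2^∞])` whose `γ`-defect `conj_γ c − c`
lies in `Sel_{2^∞}(E/ℚ_∞)` and which satisfies the archimedean Kummer condition at the CHOSEN real place of `ℚ_∞` for every infinite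
place `w` of `ℚ` (`c ∈ W.localKerOver 2 (ker κ) w.Completion`, no conjugates) lies in `Sel_{2^∞}(E/ℚ_∞)`: by §1 every conjugate
`conj_σ c` is `c + (a Selmer class)`, and Selmer classes satisfy the archimedean condition at the chosen place. Dually: the
`Γ`-invariants of the archimedean defect `Sel^{rel ∞}/Sel` inject into ONE local group `H¹(ℚ_{∞,w₀}, E[2^∞])` (order `≤ 2`).
[cite: GreenbergLNM1716, §4 Remark after Lemma 4.6 (PDF p. 106: `𝒫_E^{(v)}(F_∞) ≅ Hom(Λ/2Λ, ℤ/2ℤ)`)] -/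
theorem mem_selmerInfty_of_relaxed_of_defect_of_localKer_inf (hγ : κ.IsTopGenerator γ)
    {c : W.subgroupH1 2 κ.kerSubgroup} (hc : c ∈ relaxedSelmerInftyAtTwo W κ)
    (hdef : W.conjH1 2 κ.kerSubgroup γ c - c ∈ W.selmerInfty κ)
    (hinf : ∀ w : InfinitePlace ℚ, c ∈ W.localKerOver 2 κ.kerSubgroup w.Completion) :
    c ∈ W.selmerInfty κ := by
  have hS : ∀ s ∈ W.selmerInfty κ, W.conjH1 2 κ.kerSubgroup γ s ∈ W.selmerInfty κ := fun s hs ↦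
    W.map_conjH1_selmerGroupOver_le_holds 2 κ.kerSubgroup γ ⟨s, hs, rfl⟩
  change c ∈ W.selmerGroupOver 2 κ.kerSubgroup
  rw [W.mem_selmerGroupOver_iff]
  simp only [relaxedSelmerInftyAtTwo, AddSubgroup.mem_iInf, AddSubgroup.mem_comap] at hc
  refine ⟨hc, fun w σ ↦ ?_⟩
  have hσ := conjH1_sub_mem_of_conjH1_gen_sub_mem W κ hγ hS hdef σ
  have hsel : W.conjH1 2 κ.kerSubgroup σ c - c ∈ W.localKerOver 2 κ.kerSubgroup w.Completion := by
    have h1 := ((W.mem_selmerGroupOver_iff 2 κ.kerSubgroup _).mp hσ).2 w 1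
    rwa [W.conjH1_one_holds 2 κ.kerSubgroup, AddMonoidHom.id_apply] at h1
  have e : W.conjH1 2 κ.kerSubgroup σ c = (W.conjH1 2 κ.kerSubgroup σ c - c) + c := by abel
  rw [e]
  exact AddSubgroup.add_mem _ hsel (hinf w)

/-- **The `Γ`-invariant archimedean defect is detected at one place, kernel form**: for `c, c' ∈ Sel^{rel ∞}(ℚ_∞)` with `γ`-defects
in `Sel` and the SAME restriction behaviour at the chosen real places (`c − c' ∈ localKerOver w` for all `w`), `c − c' ∈ Sel`.
(So `[c] ↦ (c mod localKerOver w)_w` is injective on `(Sel^{rel ∞}/Sel)^Γ`.) [cite: GreenbergLNM1716, §4 Remark after Lemma 4.6 (PDF p. 106)] -/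
theorem sub_mem_selmerInfty_of_relaxed_of_defect (hγ : κ.IsTopGenerator γ)
    {c c' : W.subgroupH1 2 κ.kerSubgroup} (hc : c ∈ relaxedSelmerInftyAtTwo W κ) (hc' : c' ∈ relaxedSelmerInftyAtTwo W κ)
    (hdef : W.conjH1 2 κ.kerSubgroup γ c - c ∈ W.selmerInfty κ) (hdef' : W.conjH1 2 κ.kerSubgroup γ c' - c' ∈ W.selmerInfty κ)
    (hinf : ∀ w : InfinitePlace ℚ, c - c' ∈ W.localKerOver 2 κ.kerSubgroup w.Completion) :
    c - c' ∈ W.selmerInfty κ := by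
  refine mem_selmerInfty_of_relaxed_of_defect_of_localKer_inf W κ hγ (AddSubgroup.sub_mem _ hc hc') ?_ hinf
  have e : W.conjH1 2 κ.kerSubgroup γ (c - c') - (c - c') =
      (W.conjH1 2 κ.kerSubgroup γ c - c) - (W.conjH1 2 κ.kerSubgroup γ c' - c') := by
    rw [map_sub]; abel
  rw [e]
  exact AddSubgroup.sub_mem _ hdef hdef'

end Rigidity

/-! ## §3 `μ`-bookkeeping along the archimedean extension `q : Xr ↠ D.X` -/

section Bookkeeping

variable (W : WeierstrassCurve ℚ) [W.IsElliptic] {κ : ZpExtension ℚ 2} {γ : Field.absoluteGaloisGroup ℚ}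
  {Xr : Type*} [AddCommGroup Xr] [_root_.Module (IwasawaAlgebra 2) Xr]
  (toDualR : Xr →+ (relaxedSelmerInftyAtTwo W κ →+ AddCircle (1 : ℚ)))

omit [W.IsElliptic] in
/-- **`ℓ_𝔭(X^{rel ∞}) = ℓ_𝔭(ker q) + ℓ_𝔭(X)` at every prime `𝔭` of `Λ`**, for ANY pinned relaxed dual `(Xr, toDualR)`, ANY datum `D` of
`Sel_{2^∞}(E/ℚ_∞)` and ANY compatible `Λ`-linear `q` (which is onto: `ArchKernel.surjective_of_compat`): additivity of `ℓ_𝔭` on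
`0 → ker q → Xr → D.X → 0`. [cite: GreenbergLNM1716, §4 Lemma 4.6 and Remark (PDF pp. 105–107)] -/
theorem lengthAt_relaxed_eq_lengthAt_ker_add (hR : Function.Bijective toDualR) (D : W.SelmerDualData κ γ)
    (q : Xr →ₗ[IwasawaAlgebra 2] D.X)
    (hq : ∀ (x : Xr) (s : W.selmerInfty κ),
      D.toDual (q x) s = toDualR x (AddSubgroup.inclusion (selmerInfty_le_relaxedSelmerInftyAtTwo W κ) s))
    (𝔭 : PrimeSpectrum (IwasawaAlgebra 2)) :
    lengthAt (IwasawaAlgebra 2) Xr 𝔭 =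
      lengthAt (IwasawaAlgebra 2) (LinearMap.ker q) 𝔭 + lengthAt (IwasawaAlgebra 2) D.X 𝔭 :=
  lengthAt_eq_add_of_exact (LinearMap.ker q).subtype q (Submodule.injective_subtype _)
    (ArchKernel.surjective_of_compat (selmerInfty_le_relaxedSelmerInftyAtTwo W κ) D.toDual toDualR q.toAddMonoidHom
      D.bijective hR hq)
    (LinearMap.exact_subtype_ker_map q) 𝔭

omit [W.IsElliptic] in
/-- `ℓ_𝔭(X) ≤ ℓ_𝔭(X^{rel ∞})` at every `𝔭` (the archimedean extension is onto). [cite: GreenbergLNM1716, §4 Lemma 4.6] -/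
theorem lengthAt_selmer_le_lengthAt_relaxed (hR : Function.Bijective toDualR) (D : W.SelmerDualData κ γ)
    (q : Xr →ₗ[IwasawaAlgebra 2] D.X)
    (hq : ∀ (x : Xr) (s : W.selmerInfty κ),
      D.toDual (q x) s = toDualR x (AddSubgroup.inclusion (selmerInfty_le_relaxedSelmerInftyAtTwo W κ) s))
    (𝔭 : PrimeSpectrum (IwasawaAlgebra 2)) :
    lengthAt (IwasawaAlgebra 2) D.X 𝔭 ≤ lengthAt (IwasawaAlgebra 2) Xr 𝔭 := by
  rw [lengthAt_relaxed_eq_lengthAt_ker_add W toDualR hR D q hq 𝔭]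
  exact le_add_self

/-- **`Δ_W < 0`: `ℓ_𝔭(X^{rel ∞}) = ℓ_𝔭(X)` at every `𝔭`** (the archimedean extension is injective, `ArchKernel.archExtension_injective_of_Δ_neg`,
so `ker q = 0` has length `0`). Unconditional. [cite: GreenbergLNM1716, §4 (PDF p. 106: «usually this group is zero»)] -/
theorem lengthAt_relaxed_eq_of_Δ_neg (hΔ : W.Δ < 0) (hR : Function.Bijective toDualR) (D : W.SelmerDualData κ γ)
    (q : Xr →ₗ[IwasawaAlgebra 2] D.X)
    (hq : ∀ (x : Xr) (s : W.selmerInfty κ),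
      D.toDual (q x) s = toDualR x (AddSubgroup.inclusion (selmerInfty_le_relaxedSelmerInftyAtTwo W κ) s))
    (𝔭 : PrimeSpectrum (IwasawaAlgebra 2)) :
    lengthAt (IwasawaAlgebra 2) Xr 𝔭 = lengthAt (IwasawaAlgebra 2) D.X 𝔭 := by
  have hinj := ArchKernel.archExtension_injective_of_Δ_neg W hΔ D toDualR hR q.toAddMonoidHom hq
  have hker : LinearMap.ker q = ⊥ := LinearMap.ker_eq_bot.mpr hinj
  rw [lengthAt_relaxed_eq_lengthAt_ker_add W toDualR hR D q hq 𝔭, hker,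
    lengthAt_eq_of_linearEquiv (LinearEquiv.ofEq _ _ rfl ≪≫ₗ (Submodule.botEquivPUnit : (⊥ : Submodule (IwasawaAlgebra 2) Xr) ≃ₗ[IwasawaAlgebra 2] PUnit)) 𝔭]
  rw [show lengthAt (IwasawaAlgebra 2) PUnit 𝔭 = 0 from ?_, zero_add]
  unfold lengthAt
  exact Module.length_eq_zero

/-- **`Δ_W > 0`: `ℓ₍₂₎(X) + 1 ≤ ℓ₍₂₎(X^{rel ∞})`, GRANTED Greenberg's Lemma 4.6 at `2`** (PRINT fact p608868; `Xr` finitely generated, `D` torsion,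
`W` globally minimal good ordinary at `2`, `κ` cyclotomic): `μ₂` of the relaxed dual exceeds `μ₂(X(E/ℚ_∞))` by at least one — the archimedean
`Λ/2Λ`. Combine `lengthAt_relaxed_eq_lengthAt_ker_add` with `ArchKernel.one_le_lengthAt_ker_archExtension`.
[cite: GreenbergLNM1716, §4 Lemma 4.6 and Remark (PDF pp. 105–107)] -/
theorem lengthAt_selmer_add_one_le_lengthAt_relaxed (h46 : lemma46_relaxed_mod_selmer_infinite_rat_two) [W.IsGloballyMinimal]
    [Module.Finite (IwasawaAlgebra 2) Xr] (hord : IsOrdinaryAt W 2) (hΔ : 0 < W.Δ) (hκ : κ.IsCyclotomic) (hγ : κ.IsTopGenerator γ)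
    (D : W.SelmerDualData κ γ) (hD : D.IsTorsion) (hR : Function.Bijective toDualR) (q : Xr →ₗ[IwasawaAlgebra 2] D.X)
    (hq : ∀ (x : Xr) (s : W.selmerInfty κ),
      D.toDual (q x) s = toDualR x (AddSubgroup.inclusion (selmerInfty_le_relaxedSelmerInftyAtTwo W κ) s)) :
    lengthAt (IwasawaAlgebra 2) D.X ⟨augIdealP 2, isPrime_augIdealP_holds 2⟩ + 1 ≤
      lengthAt (IwasawaAlgebra 2) Xr ⟨augIdealP 2, isPrime_augIdealP_holds 2⟩ := by
  rw [lengthAt_relaxed_eq_lengthAt_ker_add W toDualR hR D q hq, add_comm]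
  exact add_le_add_left (ArchKernel.one_le_lengthAt_ker_archExtension W h46 hord hΔ hκ hγ D hD toDualR hR q hq) _

end Bookkeeping

end Summit.BirchSwinnertonDyer.BirchSwinnertonDyer.Theorems.AlignedTransportAtTwoFineRoad.ArchRigidity

end
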